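import Literature.Computability.AlgebraicComplexity.FSV18SparseHittingProofs
import HarnessLib

/-!
# Rank concentration to hitting, and `k`-wise independence of `G^{SSV}`: discharges of
# `FSV2018_lemma42` and `FSV2018_lemma41` (Forbes–Shpilka–Volk 2018, §5.3, Lemmas 41–42 =
# [Forbes–Saptharishi–Shpilka 2014, Lemma 29 and Cor. 3.5])

Sibling proofs file of `FSV18SuccinctGenerators.lean` (§5.3, commutative read-once oblivious ABPs).
FSV Lemma 42 (ToC Lemma 5.18) as printed: "Let `F ∈ 𝔽[X]^{r×r}` be a matrix of polynomials that
is support-`k` rank concentrated at `α ∈ 𝔽^N`, and let `G(X) = F_{1,1}`. Then `G(X) ≢ 0` if and only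
if `G ∘ (G^{SSV}_{n,k} + α) ≢ 0`", with the remark "although [FSS14] phrase this lemma for their
construction of the SV generator, the proof goes through verbatim using the properties of
`G^{SSV}_{n,k}` as explained in the proof of Lemma 41" (i.e. the planting of Lemma 28). The tree's
named fact `FSV2018_lemma42` is the non-trivial direction; it is PROVED here
(`FSV2018_lemma42_holds`) following the printed architecture:

* `aeval_X_add_C_ne_zero` — the shift `X ↦ X + α` is injective, so `G(X + α) ≢ 0`.
* `IsRankConcentrated.exists_narrow` — the linear-algebra step of [FSS14, Cor. 3.5]: the
  coefficient vectors `∂_{X^a} F(α) = coeff_a F(X + α) ∈ K^{r×r}` all lie in the span of those with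
  `|supp a| ≤ k` (Def. 39); if every such low-support vector had a vanishing `(1,1)` entry, so would
  the whole span (it sits in the kernel of the coordinate projection), i.e. every coefficient of
  `G(X + α)` would vanish. Hence `G(X + α)` has a nonzero coefficient at some `a` with `|supp a| ≤ k`.
* `aeval_plantSubst_ssvGenCoeff` / `bind₁_ssvGenCoeff_add_C_ne_zero_of_narrow` — FSV Lemma 28's
  planting for the UNSHIFTED generator `G^{SSV}_{n,k}` (tree: `ssvGenCoeff`; the shifted
  `svGenCoeff = ssvGenCoeff + 1` is treated in `FSV18SparseHittingProofs.lean`, whose `plantSubst` /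
  `plantOf` are reused): planting the `≤ k` coordinates of `supp a` turns `G ∘ (G^{SSV}_{n,k} + α)`
  into `G(X + α)` with the coordinates outside `supp a` killed, which keeps the coefficient of `a`
  (`SparseShift.coeff_subst_self`).

FSV Lemma 41 (ToC Lemma 5.17): "The polynomial map `G^{SSV}_{n,k}(y,z)` of Construction 25 is an
individual degree `d`, `k`-wise independent monomial map for every `d`" (Def. 38), typed as
`FSV2018_lemma41` with the scope `k ≤ 2ⁿ`; PROVED here (`FSV2018_lemma41_holds`) by the printed
fixing of the `z`'s (`bind₁_indicatorFix_ssvGenCoeff`: under `z_j := 𝟙_{supp (t j)}` the coordinate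
`m` of `G^{SSV}` is `∑_{j : t j = m} y_j`), assigning the first `|S|` blocks to the members of `S` and
the spare blocks to a coordinate outside `S` (`exists_not_mem_of_card_lt_two_pow`, where `k ≤ 2ⁿ`
enters).

No new statements; no named facts introduced.

## References
* [ForbesShpilkaVolk2018] M. Forbes, A. Shpilka, B. L. Volk, *Succinct hitting sets and barriers to
  proving lower bounds for algebraic circuits*, Theory Comput. 14 (2018), arXiv:1701.05328:
  Construction 25, Lemma 28, Defs. 38–39, Lemmas 41–42 (§5.3, p. 28).
  locator: paper:arxiv-1701.05328 p0020.txt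
* [ForbesSaptharishiShpilka2014] M. Forbes, R. Saptharishi, A. Shpilka, *Hitting sets for multilinear
  read-once algebraic branching programs, in any order*, STOC 2014, Lemma 29 and Cor. 3.5 (= arXiv:1309.5668
  Lemmas 10–11, Cor. 12, Lemma 29; locator: paper:arxiv-1309.5668 p0011–p0012, p0017–p0018).
-/

noncomputable section

namespace Literature.Computability.AlgebraicComplexity

open MvPolynomial

/-! ### The shift `X ↦ X + α` is injective -/

/-- Shifting the variables by constants is injective: `D ≠ 0 ⇒ D(X + a) ≠ 0` (the inverse shift
`X ↦ X - a` undoes it; the trivial half of "`G(X) ≢ 0` if and only if `G ∘ (G^{SSV}_{n,k} + α) ≢ 0`").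
[cite: ForbesShpilkaVolk2018, Lemma 42, proof] -/
theorem aeval_X_add_C_ne_zero {σ R : Type*} [CommRing R] (a : σ → R) {D : MvPolynomial σ R}
    (hD : D ≠ 0) : aeval (fun i => (X i + C (a i) : MvPolynomial σ R)) D ≠ 0 := by
  intro h0
  apply hD
  have key : aeval (fun i => (X i - C (a i) : MvPolynomial σ R))
      (aeval (fun i => (X i + C (a i) : MvPolynomial σ R)) D) = D := by
    rw [← AlgHom.comp_apply, comp_aeval]
    have hX : (fun i => aeval (fun i => (X i - C (a i) : MvPolynomial σ R))
        (X i + C (a i) : MvPolynomial σ R)) = X := by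
      funext i
      simp
    rw [hX, aeval_X_left, AlgHom.id_apply]
  rw [← key, h0, map_zero]

/-! ### Rank concentration (FSV Def. 39) forces a narrow nonzero coefficient -/

section RankConcentration

variable {K : Type*} [Field K] {ι ρ : Type*}

/-- **The linear-algebra step of [FSS14, Cor. 3.5] / FSV Lemma 42.** If the family `Fv` is
support-`k` rank concentrated at `v` (FSV Def. 39: the coefficient vectors of `Fv(X + v)` at the
monomials of support `≤ k` span all its coefficient vectors) and the entry `Fv j₀` is nonzero after
the shift, then `(Fv j₀)(X + v)` has a nonzero coefficient at a monomial of support at most `k`: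
otherwise every low-support coefficient vector, hence their span, hence every coefficient vector,
has a vanishing `j₀` entry. [cite: ForbesShpilkaVolk2018, Lemma 42 (= FSS14 Cor. 3.5), proof] -/
theorem IsRankConcentrated.exists_narrow {k : ℕ} {Fv : ρ → MvPolynomial ι K} {v : ι → K}
    (h : IsRankConcentrated k Fv v) (j₀ : ρ)
    (hj : aeval (fun i => (X i + C (v i) : MvPolynomial ι K)) (Fv j₀) ≠ 0) :
    ∃ a : ι →₀ ℕ, a.support.card ≤ k ∧
      coeff a (aeval (fun i => (X i + C (v i) : MvPolynomial ι K)) (Fv j₀)) ≠ 0 := by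
  by_contra hcon
  push Not at hcon
  apply hj
  -- the vectors with vanishing `j₀` entry form a submodule containing every low-support vector
  have hlow : Submodule.span K (Set.range fun a : {a : ι →₀ ℕ // a.support.card ≤ k} =>
      fun j : ρ => coeff a.1 (aeval (fun i => (X i + C (v i) : MvPolynomial ι K)) (Fv j))) ≤
      LinearMap.ker (LinearMap.proj (R := K) (φ := fun _ : ρ => K) j₀) := by
    rw [Submodule.span_le]
    rintro _ ⟨a, rfl⟩
    simp only [SetLike.mem_coe, LinearMap.mem_ker, LinearMap.proj_apply]
    exact hcon a.1 a.2
  ext b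
  rw [coeff_zero]
  -- every coefficient vector lies in the full span, which is the low-support span
  have hb : (fun j : ρ => coeff b (aeval (fun i => (X i + C (v i) : MvPolynomial ι K)) (Fv j))) ∈
      Submodule.span K (Set.range fun a : ι →₀ ℕ =>
        fun j : ρ => coeff a (aeval (fun i => (X i + C (v i) : MvPolynomial ι K)) (Fv j))) :=
    Submodule.subset_span ⟨b, rfl⟩
  rw [← h] at hb
  have hker := hlow hb
  rw [LinearMap.mem_ker, LinearMap.proj_apply] at hker
  exact hker

end RankConcentration

/-! ### Planting for the unshifted generator `G^{SSV}_{n,k}` (FSV Lemma 28) -/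

section Planting

variable {F : Type*} [Field F] {n k : ℕ}

/-- **FSV Lemma 28 for the unshifted `ssvGenCoeff`.** If `P` assigns seed blocks injectively with
image `T`, then under the planting substitution the coordinate of `G^{SSV}_{n,k}` at `m` is `c_m` for
`m ∈ T` and `0` otherwise ("`|T|` distinct `y` variables are planted in the coordinates corresponding
to `T`, while the rest of the entries are zeroed out"). From the shifted version
`aeval_plantSubst_svGenCoeff` (`svGenCoeff = ssvGenCoeff + 1`).
[cite: ForbesShpilkaVolk2018, Lemma 28 = ToC Lemma 5.4, p. 24] -/
theorem aeval_plantSubst_ssvGenCoeff (P : Fin k → Option (multilinearMonomials n))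
    (hinj : ∀ j j' t, P j = some t → P j' = some t → j = j')
    (T : Finset (multilinearMonomials n)) (hT : ∀ t, t ∈ T ↔ ∃ j, P j = some t)
    (m : multilinearMonomials n) :
    aeval (plantSubst (F := F) P) (ssvGenCoeff F n k (m : Fin n →₀ ℕ)) =
      if m ∈ T then X m else 0 := by
  have h := aeval_plantSubst_svGenCoeff (F := F) P hinj T hT m
  rw [svGenCoeff_eq_ssvGenCoeff_add_one, map_add, map_one] at h
  exact add_right_cancel h

/-- **Planting for `G ∘ (G^{SSV}_{n,k} + α)` (the mechanism of FSV Lemma 42 / Lemma 31).** If the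
shift `G(X + α)` has a nonzero coefficient at a monomial `a` involving at most `k` coordinates, then
`G ∘ (G^{SSV}_{n,k} + α)` (substitute `ssvGenCoeff n k m + α_m` for `c_m`) is a nonzero polynomial in
the seeds: under the planting substitution for `T = supp a` it becomes `G(X + α)` with the
coordinates outside `T` killed, which retains the coefficient of `a`.
[cite: ForbesShpilkaVolk2018, Lemma 42 (= FSS14 Cor. 3.5) with Lemma 28, p. 28] -/
theorem bind₁_ssvGenCoeff_add_C_ne_zero_of_narrow {G : MvPolynomial (multilinearMonomials n) F}
    (α : multilinearMonomials n → F) {a : multilinearMonomials n →₀ ℕ}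
    (ha : a ∈ (aeval (fun v : multilinearMonomials n =>
      (X v + C (α v) : MvPolynomial (multilinearMonomials n) F)) G).support)
    (hk : a.support.card ≤ k) :
    bind₁ (fun m : multilinearMonomials n => ssvGenCoeff F n k (m : Fin n →₀ ℕ) + C (α m)) G ≠ 0 := by
  classical
  set T := a.support with hTdef
  -- killing the coordinates outside `T` keeps the coefficient of `a`
  have hE : aeval (fun v : multilinearMonomials n =>
      if v ∈ T then (X v : MvPolynomial (multilinearMonomials n) F) else 0)
        (aeval (fun v : multilinearMonomials n =>
          (X v + C (α v) : MvPolynomial (multilinearMonomials n) F)) G) ≠ 0 := by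
    intro h0
    have h := SparseShift.coeff_subst_self T
      (aeval (fun v : multilinearMonomials n =>
        (X v + C (α v) : MvPolynomial (multilinearMonomials n) F)) G) (subset_refl T)
    rw [h0, coeff_zero] at h
    exact (mem_support_iff.mp ha) h.symm
  -- the composite substitution is `c_v ↦ (if v ∈ T then c_v else 0) + α_v`
  have hcomp : aeval (fun v : multilinearMonomials n =>
      if v ∈ T then (X v : MvPolynomial (multilinearMonomials n) F) else 0)
        (aeval (fun v : multilinearMonomials n =>
          (X v + C (α v) : MvPolynomial (multilinearMonomials n) F)) G) =
      aeval (fun v : multilinearMonomials n =>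
        (if v ∈ T then (X v : MvPolynomial (multilinearMonomials n) F) else 0) + C (α v)) G := by
    rw [← AlgHom.comp_apply, comp_aeval]
    exact congrArg (fun g => aeval g G) (funext fun v => by rw [map_add, aeval_X, aeval_C, algebraMap_eq])
  -- under the planting substitution for `T`, `G ∘ (G^{SSV} + α)` becomes that composite
  have key : aeval (plantSubst (F := F) (plantOf (k := k) T))
      (bind₁ (fun m : multilinearMonomials n => ssvGenCoeff F n k (m : Fin n →₀ ℕ) + C (α m)) G) =
      aeval (fun v : multilinearMonomials n =>
        (if v ∈ T then (X v : MvPolynomial (multilinearMonomials n) F) else 0) + C (α v)) G := by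
    rw [aeval_bind₁]
    exact congrArg (fun g => aeval g G) (funext fun m => by
      rw [map_add, aeval_C, algebraMap_eq,
        aeval_plantSubst_ssvGenCoeff (F := F) (plantOf T) (plantOf_inj T) T
          (mem_iff_exists_plantOf T hk) m])
  intro h0
  apply hE
  rw [hcomp, ← key, h0, map_zero]

end Planting

/-! ### Discharge -/

/-- **Discharge of `FSV2018_lemma42`** (FSV Lemma 42 = ToC Lemma 5.18 = [FSS14, Cor. 3.5]): a matrix
family `Fv` support-`k` rank concentrated at `α` with `G = Fv (0,0) ≢ 0` has
`G ∘ (G^{SSV}_{n,k} + α) ≢ 0` — the shift is injective (`aeval_X_add_C_ne_zero`), rank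
concentration yields a nonzero coefficient of `G(X + α)` at a support-`≤ k` monomial
(`IsRankConcentrated.exists_narrow`), and planting that support keeps it
(`bind₁_ssvGenCoeff_add_C_ne_zero_of_narrow`). [cite: ForbesShpilkaVolk2018, Lemma 42, p. 28] -/
theorem FSV2018_lemma42_holds : FSV2018_lemma42 := by
  intro K _ n k r Fv α hRC hG
  obtain ⟨a, hak, ha⟩ := hRC.exists_narrow (0, 0) (aeval_X_add_C_ne_zero α hG)
  exact bind₁_ssvGenCoeff_add_C_ne_zero_of_narrow α (mem_support_iff.mpr ha) hak

/-! ### `G^{SSV}_{n,k}` is a `k`-wise independent monomial map (FSV Lemma 41 = FSS14 Lemma 29) -/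

section IndepMonomialMap

variable {F : Type*} [Field F] {n k : ℕ}

/-- One factor of `G^{SSV}` under **the `z`-fixing of FSV Lemma 41's proof** for a
block-to-coordinate assignment `t : [k] → {coordinates}` — block `j` gets `z_{j,i} := [(t j)_i ≠ 0]`,
the indicator vector of the support of its coordinate ("we can set the `z` variables such that each
coordinate in `S` contains a distinct `y` variable"): the factor at variable `i` of coordinate `m` in
block `j` is `[m_i = 0 ↔ (t j)_i = 0]`.
[cite: ForbesShpilkaVolk2018, Lemma 41 (proof) = ToC Lemma 5.17 with Lemma 28, p. 28] -/
theorem bind₁_indicatorFix_factor (t : Fin k → multilinearMonomials n) (j : Fin k)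
    (m : multilinearMonomials n) (i : Fin n) :
    bind₁ (Sum.elim X fun p : Fin k × Fin n => C (if ((t p.1 : Fin n →₀ ℕ) p.2 = 0) then (0 : F) else 1))
        ((if (m : Fin n →₀ ℕ) i = 0 then 1 - X (Sum.inr (j, i)) else X (Sum.inr (j, i))) :
          MvPolynomial (Fin k ⊕ (Fin k × Fin n)) F) =
      if ((m : Fin n →₀ ℕ) i = 0 ↔ (t j : Fin n →₀ ℕ) i = 0) then 1 else 0 := by
  by_cases hm : (m : Fin n →₀ ℕ) i = 0 <;> by_cases ht : (t j : Fin n →₀ ℕ) i = 0 <;>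
    simp [hm, ht, map_sub]

/-- **`G^{SSV}_{n,k}` under the indicator fixing** (all `y`'s kept as variables): the coordinate
`m` becomes `∑_{j : t j = m} y_j` — block `j` contributes `y_j · [m = t j]`.
[cite: ForbesShpilkaVolk2018, Lemma 41 (proof) with Lemma 28, p. 28] -/
theorem bind₁_indicatorFix_ssvGenCoeff (t : Fin k → multilinearMonomials n)
    (m : multilinearMonomials n) :
    bind₁ (Sum.elim X fun p : Fin k × Fin n => C (if ((t p.1 : Fin n →₀ ℕ) p.2 = 0) then (0 : F) else 1))
        (ssvGenCoeff F n k (m : Fin n →₀ ℕ)) =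
      ∑ j : Fin k, if t j = m then (X j : MvPolynomial (Fin k) F) else 0 := by
  classical
  rw [ssvGenCoeff, map_sum]
  refine Finset.sum_congr rfl fun j _ => ?_
  rw [map_mul, bind₁_X_right, Sum.elim_inl, map_prod,
    Finset.prod_congr rfl fun i _ => bind₁_indicatorFix_factor t j m i, Fintype.prod_boole]
  by_cases hmt : t j = m
  · subst hmt
    simp
  · have hne : ¬ ∀ i, ((m : Fin n →₀ ℕ) i = 0 ↔ (t j : Fin n →₀ ℕ) i = 0) :=
      fun h => hmt (multilinear_eq_of_zero_iff h).symm
    simp [hne, hmt]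

omit [Field F] in
/-- There are `2ⁿ` multilinear coordinates (`x_T`, `T ⊆ [n]`), so a set of fewer than `2ⁿ` of them
misses one. [cite: ForbesShpilkaVolk2018, §1.5 (N = 2ⁿ coefficients of multilinear polynomials)] -/
theorem exists_not_mem_of_card_lt_two_pow (S : Finset (multilinearMonomials n))
    (hS : S.card < 2 ^ n) : ∃ t : multilinearMonomials n, t ∉ S := by
  classical
  let emb : Finset (Fin n) ↪ multilinearMonomials n :=
    ⟨fun T => ⟨subsetExp T, subsetExp_mem T⟩,
      fun T T' h => subsetExp_injective (congrArg Subtype.val h)⟩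
  have hcard : ((Finset.univ : Finset (Finset (Fin n))).map emb).card = 2 ^ n := by
    rw [Finset.card_map, Finset.card_univ, Fintype.card_finset, Fintype.card_fin]
  obtain ⟨t, -, ht⟩ := Finset.exists_mem_notMem_of_card_lt_card (hS.trans_eq hcard.symm)
  exact ⟨t, ht⟩

/-- **Discharge of `FSV2018_lemma41`** (FSV Lemma 41 = ToC Lemma 5.17; [FSS14, Lemma 29] for the SV
generator): for `k ≤ 2ⁿ`, `G^{SSV}_{n,k}(y, z)` is an individual degree `d`, `k`-wise independent
monomial map for every `d`. Printed proof: "for any set `S` of coordinates of size at most `k` we can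
set the `z` variables such that each coordinate in `S` contains a distinct `y` variable. Then … all
individual degree up to `d` monomials of this map are distinct, for any choice of `d`." Here: the
first `|S|` blocks are assigned to the members of `S` (`z_j := 𝟙_{supp}` of the `j`-th member), the
spare blocks to one fixed coordinate OUTSIDE `S` (it exists as `|S| < k ≤ 2ⁿ` whenever there is a
spare block — the reason for the scope `k ≤ 2ⁿ` of the typed fact); then coordinate `i ∈ S` carries
exactly `y_{e(i)}` for the injective `e : S ↪ [k]`, so `∏_{i} (G_i)^{a_i} = y^{e_* a}` with `e_* a`
injective in `a` (support in `S`). [cite: ForbesShpilkaVolk2018, Lemma 41, p. 28] -/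
theorem FSV2018_lemma41_holds : FSV2018_lemma41 := by
  intro F _ n k d hk S hS
  classical
  -- a coordinate outside `S` for the spare blocks (needed only when `|S| < k ≤ 2ⁿ`)
  obtain ⟨tstar, htstar⟩ : ∃ t : multilinearMonomials n, S.card < k → t ∉ S := by
    by_cases h : S.card < k
    · obtain ⟨t, ht⟩ := exists_not_mem_of_card_lt_two_pow S (lt_of_lt_of_le h hk)
      exact ⟨t, fun _ => ht⟩
    · exact ⟨⟨0, by intro i; simp⟩, fun h' => absurd h' h⟩
  -- block assignment: the first `|S|` blocks to the members of `S`, the others to `tstar`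
  set t : Fin k → multilinearMonomials n := fun j =>
    if h : (j : ℕ) < S.card then ((S.equivFin.symm ⟨j, h⟩ : S) : multilinearMonomials n) else tstar
    with ht_def
  set e : S → Fin k := fun i => Fin.castLE hS (S.equivFin i) with he_def
  have he_inj : Function.Injective e := by
    intro i i' h
    apply S.equivFin.injective
    apply Fin.ext
    have h' := congrArg Fin.val h
    rw [he_def] at h'
    simpa using h'
  have ht_e : ∀ i : S, t (e i) = (i : multilinearMonomials n) := by
    intro i
    have hlt : ((e i : Fin k) : ℕ) < S.card := (S.equivFin i).2
    have hidx : (⟨((e i : Fin k) : ℕ), hlt⟩ : Fin S.card) = S.equivFin i := Fin.ext rfl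
    rw [ht_def]
    dsimp only
    rw [dif_pos hlt, hidx, Equiv.symm_apply_apply]
  have ht_ne : ∀ (i : S) (j : Fin k), j ≠ e i → t j ≠ (i : multilinearMonomials n) := by
    intro i j hj htj
    apply hj
    by_cases hlt : (j : ℕ) < S.card
    · rw [ht_def] at htj
      dsimp only at htj
      rw [dif_pos hlt] at htj
      have h1 : S.equivFin.symm ⟨j, hlt⟩ = i := Subtype.ext htj
      have h2 : (⟨(j : ℕ), hlt⟩ : Fin S.card) = S.equivFin i := by
        rw [← h1, Equiv.apply_symm_apply]
      apply Fin.ext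
      have h3 := congrArg Fin.val h2
      rw [he_def]
      simpa using h3
    · exfalso
      rw [ht_def] at htj
      dsimp only at htj
      rw [dif_neg hlt] at htj
      have hSk : S.card < k := lt_of_le_of_lt (not_lt.mp hlt) j.2
      exact htstar hSk (htj ▸ i.2)
  -- coordinate `i ∈ S` of the fixed generator is exactly `y_{e i}`
  have hcoord : ∀ i : S, bind₁ (Sum.elim X fun p : Fin k × Fin n => C (if ((t p.1 : Fin n →₀ ℕ) p.2 = 0) then (0 : F) else 1))
      (ssvGenCoeff F n k ((i : multilinearMonomials n) : Fin n →₀ ℕ)) = X (e i) := by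
    intro i
    rw [bind₁_indicatorFix_ssvGenCoeff, Finset.sum_eq_single (e i)]
    · rw [if_pos (ht_e i)]
    · intro j _ hj
      rw [if_neg (ht_ne i j hj)]
    · intro h
      exact absurd (Finset.mem_univ _) h
  -- reading an exponent supported in `S` back off `e_* a`
  have key : ∀ (c : multilinearMonomials n →₀ ℕ) (i₀ : S),
      (∑ i ∈ S.attach, Finsupp.single (e i) (c i)) (e i₀) = c i₀ := by
    intro c i₀
    rw [Finsupp.finsetSum_apply, Finset.sum_eq_single i₀]
    · rw [Finsupp.single_eq_same]
    · intro i _ hi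
      exact Finsupp.single_eq_of_ne fun h => hi (he_inj h).symm
    · intro h
      exact absurd (Finset.mem_attach _ _) h
  refine ⟨fun p => if ((t p.1 : Fin n →₀ ℕ) p.2 = 0) then 0 else 1, fun a => ∑ i ∈ S.attach, Finsupp.single (e i) (a i), ?_, ?_⟩
  · -- injectivity on the exponents supported in `S`
    intro a ha b hb hab
    have hab' : ∀ i₀ : S, a i₀ = b i₀ := fun i₀ => by
      have h := congrArg (fun f : Fin k →₀ ℕ => f (e i₀)) hab
      simpa only [key] using h
    ext i
    by_cases hi : i ∈ S
    · exact hab' ⟨i, hi⟩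
    · rw [Finsupp.notMem_support_iff.mp fun h => hi (ha.1 h),
        Finsupp.notMem_support_iff.mp fun h => hi (hb.1 h)]
  · -- the products are the monomials `y^{e_* a}`
    intro a ha _
    refine ⟨1, one_ne_zero, ?_⟩
    calc ∏ i ∈ a.support, (bind₁ (Sum.elim X fun p : Fin k × Fin n => C (if ((t p.1 : Fin n →₀ ℕ) p.2 = 0) then (0 : F) else 1))
            (ssvGenCoeff F n k ((i : multilinearMonomials n) : Fin n →₀ ℕ))) ^ a i
        = ∏ i ∈ S, (bind₁ (Sum.elim X fun p : Fin k × Fin n => C (if ((t p.1 : Fin n →₀ ℕ) p.2 = 0) then (0 : F) else 1))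
            (ssvGenCoeff F n k ((i : multilinearMonomials n) : Fin n →₀ ℕ))) ^ a i := by
          refine Finset.prod_subset ha fun i _ hi => ?_
          rw [Finsupp.notMem_support_iff.mp hi, pow_zero]
      _ = ∏ i ∈ S.attach, (bind₁ (Sum.elim X fun p : Fin k × Fin n => C (if ((t p.1 : Fin n →₀ ℕ) p.2 = 0) then (0 : F) else 1))
            (ssvGenCoeff F n k (((i : S) : multilinearMonomials n) : Fin n →₀ ℕ))) ^ a i :=
          (Finset.prod_attach S _).symm
      _ = ∏ i ∈ S.attach, (X (e i) : MvPolynomial (Fin k) F) ^ a i :=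
          Finset.prod_congr rfl fun i _ => by rw [hcoord i]
      _ = ∏ i ∈ S.attach, monomial (Finsupp.single (e i) (a i)) (1 : F) :=
          Finset.prod_congr rfl fun i _ => X_pow_eq_monomial
      _ = monomial (∑ i ∈ S.attach, Finsupp.single (e i) (a i)) 1 :=
          (monomial_sum_one _ _).symm

end IndepMonomialMap

end Literature.Computability.AlgebraicComplexity
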